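import Summits.BirchSwinnertonDyer.BirchSwinnertonDyer.Theorems.CountingDoorF2AtThreeSchneiderOnDoorSubfamilyTransportSigma
import Summits.BirchSwinnertonDyer.BirchSwinnertonDyer.Theses.CountingDoorF2AtThree
import Summits.BirchSwinnertonDyer.Rank2.F2MemberLocalData
import Literature.NumberTheory.EllipticCurves.PAdicRegulatorFiniteIndexProofs
import Literature.NumberTheory.EllipticCurves.BSDInvariantsRegulatorProofs
import Literature.NumberTheory.EllipticCurves.BSDInvariantsProofs
import HarnessLib

/-!
# Transport of the canonical `3`-adic height datum and of Schneider's non-degeneracy between two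
# globally minimal models; the transport stub of line `valuation-class-at-three` (cell bsd-rank2,
# crux I4loc `SchneiderOnDoorSubfamily` of route `CountingDoorF2AtThree` — part 2/2)

Cell-side proof file (seat bsd-rank2-cd-transport; `--supports stmt-BirchSwinnertonDyer-19682`).
Part 1 (`CountingDoorF2AtThreeSchneiderOnDoorSubfamilyTransportSigma.lean`) proved that the sigma
formula `ĥ_p(P) = log_p(den x(P)) - 2 log_p σ_p(z(P))` takes the same value on a point of `E₁` read
on two globally minimal models `W`, `C • W` (`u = ±1`, `r, s, t ∈ ℤ`) once a Mazur–Tate pair exists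
for `(C • W) ⊗ ℚ_p` and `W` is good ordinary at the odd prime `p`. Here:

* `exists_mazurTatePair_smul` — a Mazur–Tate pair for `W ⊗ ℚ_p` gives one for `(C • W) ⊗ ℚ_p`;
* `exists_isCanonical_pullback` — the pull-back of THE canonical datum of `C • W` along
  `φ = pointEquiv W C` is THE canonical datum of `W` (quadratic forms agree on doubly-admissible
  points, which contain a multiple of every non-torsion point: `exists_admissible_nsmul_holds`,
  `exists_addSubgroup_coe_eq_localConditionsLocus`, `PAdicHeightData.ext_of_sq_eq_on`);
* `schneiderConjecture_of_pairing_eq_pointEquiv` — `Reg(D) ≠ 0 ⇒ Reg(D') ≠ 0` when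
  `⟨P, Q⟩_D = ⟨φP, φQ⟩_{D'}` (Mordell–Weil bases map to Mordell–Weil bases; index formula);
* `schneiderConjecture_transport` (pair for `(C • W) ⊗ ℚ_p` as hypothesis) and
  `schneiderConjecture_transport_of_mazur_tate_sigma_exists_odd` (under the named fact);
* for Bhargava–Ho's `F₂` at `p = 3`: `isGloballyMinimal_curve_of_squarefree` (the square-free sieve
  `ℓ² ∤ Δ(a)` makes `a.curve` globally minimal), `good_ordinary_three_curve_of_smul`, and the stub in
  two forms — **`schClause_of_exists_mazurTatePair`** (registered v3 signature of `stub_transport` +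
  `∃` a Mazur–Tate pair for `a.curve ⊗ ℚ_3`) and **`schClause_of_mazur_tate_sigma_exists_odd`**
  (registered v3 signature + the named fact `mazur_tate_sigma_exists_odd`, conjunct 2 of the route's
  `PublishedInputsAtThree`).

WHY THE EXTRA HYPOTHESIS (the registered v3 signature is not closable as typed): the predicate
`PAdicHeightData.IsCanonical` is built on the CHOSEN series `padicSigma (W ⊗ ℚ_3)`, which is a
genuine sigma function only if a Mazur–Tate pair exists (at `p = 3` this is the named fact; the tree's
existence theorem `mazur_tate_sigma_existsUnique_holds` is `p ≥ 5`). In the junk branch (`σ = t` on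
both models) the sigma formula is NOT invariant under `r, s, t ≠ 0`
(`ĥ'(P') - ĥ(P) = -2 log₃((1 - r/x)/(1 - (s(x - r) + t)/y)) ≠ 0`), so Schneider for the junk-canonical
data of `a.curve` says nothing about those of `C • a.curve`.

PARTITION: none — r_an ≥ 2, summit axis S0; TWIN (D-0056): n/a. B1 honesty: model-change
bookkeeping for `p`-adic heights and regulators; no Selmer group, `L`-value or analytic rank.

References: B. Mazur, J. Tate, Duke Math. J. 62 (1991) Thm. 3.1 [MazurTate1991]; B. Mazur,
W. Stein, J. Tate, Doc. Math. Extra Vol. (2006) Thm. 1.3, §1 [MazurSteinTate2006]; B. Mazur, J. Tate,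
J. Teitelbaum, Invent. Math. 84 (1986) §II.4 [MazurTateTeitelbaum1986Invent]; P. Schneider, Invent.
Math. 69 (1982) §1 [Schneider1982PadicHeightI]; J. H. Silverman, *AEC* (2009) VII.1.3(b), VII.1
Rem. 1.1, VIII.8.3 [SilvermanAEC2009]. Pure proof file: no definition, no named fact, no instance.
-/

noncomputable section

set_option linter.dupNamespace false

open scoped Classical
open PowerSeries Literature.NumberTheory.EllipticCurves

namespace Summit.BirchSwinnertonDyer.BirchSwinnertonDyer.Theorems

section Rat

open WeierstrassCurve

variable {p : ℕ} [Fact p.Prime]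

/-! ### C. The canonical datum and Schneider's non-degeneracy transport -/

/-- **A Mazur–Tate pair transports from `W` to `C • W`** for two globally minimal models (`C⁻¹` has
`u = ±1`, `r, s, t ∈ ℤ`; `exists_isMazurTateSigmaPair_of_variableChange` along `C⁻¹`).
[cite: MazurTate1991, Thm. 3.1] -/
theorem exists_mazurTatePair_smul (W : WeierstrassCurve ℚ) [W.IsElliptic] [W.IsGloballyMinimal]
    (C : VariableChange ℚ) [(C • W).IsGloballyMinimal]
    (hσ : ∃ σ : ℚ_[p]⟦X⟧, ∃ c : ℚ_[p], (W.baseChange ℚ_[p]).IsMazurTateSigmaPair σ c) :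
    ∃ σ : ℚ_[p]⟦X⟧, ∃ c : ℚ_[p], ((C • W).baseChange ℚ_[p]).IsMazurTateSigmaPair σ c := by
  haveI : (C⁻¹ • (C • W)).IsGloballyMinimal := by rw [inv_smul_smul]; infer_instance
  obtain ⟨hu, r, s, t, hr, hs, ht⟩ := isGloballyMinimal_unique_holds (C • W) C⁻¹
  have hvu : ‖((C⁻¹.baseChange ℚ_[p]).u : ℚ_[p])‖ = 1 := by
    rw [coe_u_baseChange_padic]
    rcases hu with hu | hu <;> simp [hu]
  have hvr : ‖(C⁻¹.baseChange ℚ_[p]).r‖ ≤ 1 := by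
    rw [r_baseChange_padic, hr, Rat.cast_intCast]; exact Padic.norm_int_le_one r
  have hvs : ‖(C⁻¹.baseChange ℚ_[p]).s‖ ≤ 1 := by
    rw [s_baseChange_padic, hs, Rat.cast_intCast]; exact Padic.norm_int_le_one s
  have hvt : ‖(C⁻¹.baseChange ℚ_[p]).t‖ ≤ 1 := by
    rw [t_baseChange_padic, ht, Rat.cast_intCast]; exact Padic.norm_int_le_one t
  refine exists_isMazurTateSigmaPair_of_variableChange (V := (C • W).baseChange ℚ_[p])
    (vc := C⁻¹.baseChange ℚ_[p]) hvu hvr hvs hvt ?_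
  rw [← baseChange_padic_smul, inv_smul_smul]
  exact hσ

/-- **The pull-back of a canonical datum is canonical.** Let `W/ℚ` and `C • W` be two globally
minimal models of an elliptic curve and `p` an odd prime of good ordinary reduction for `W`, and
assume a Mazur–Tate pair exists for `(C • W) ⊗ ℚ_p` (Mazur–Tate 1991, Thm. 3.1; in the tree a
theorem for `p ≥ 5` and the named fact `mazur_tate_sigma_exists_odd` at `p = 3`). If `D'` is THE
canonical `p`-adic height datum of `C • W`, then its pull-back along the isomorphism of point groups
`φ = pointEquiv W C` (pairing `(P, Q) ↦ ⟨φ P, φ Q⟩_{D'}`) is THE canonical datum of `W`: both it and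
the canonical datum of `W` (from the transported pair, `exists_isCanonical_of_thetaLHS_eq`) are
symmetric bilinear torsion-vanishing pairings whose quadratic forms agree on every point admissible
on both models (`canonicalPAdicHeight_pointEquiv`), and every non-torsion point has such a multiple
(`exists_admissible_nsmul_holds` on both models, the admissible loci being subgroups,
`exists_addSubgroup_coe_eq_localConditionsLocus`), so they coincide
(`PAdicHeightData.ext_of_sq_eq_on`). [cite: MazurSteinTate2006, §1 ("extends uniquely")]
[cite: MazurTate1991, Thm. 3.1] -/
theorem exists_isCanonical_pullback (W : WeierstrassCurve ℚ) [W.IsElliptic] [W.IsGloballyMinimal]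
    (C : VariableChange ℚ) [(C • W).IsGloballyMinimal] (hp2 : p ≠ 2)
    (hgood : W.HasGoodReductionAtPrime p) (hord : ¬ (p : ℤ) ∣ W.frobeniusTrace p)
    (hσ' : ∃ σ : ℚ_[p]⟦X⟧, ∃ c : ℚ_[p], ((C • W).baseChange ℚ_[p]).IsMazurTateSigmaPair σ c)
    (D' : PAdicHeightData (C • W) p) (hD' : D'.IsCanonical) :
    ∃ D : PAdicHeightData W p, D.IsCanonical ∧
      ∀ P Q, D.pairing P Q =
        D'.pairing (VariableChange.pointEquiv W C P) (VariableChange.pointEquiv W C Q) := by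
  obtain ⟨hu, hrst⟩ := isGloballyMinimal_unique_holds W C
  -- the pulled-back datum
  let D : PAdicHeightData W p :=
    { pairing := (D'.pairing.comp (VariableChange.pointEquiv W C).toAddMonoidHom).compl₂
        (VariableChange.pointEquiv W C).toAddMonoidHom
      symm := fun P Q => D'.symm _ _
      map_torsion := fun P Q hP => D'.map_torsion _ _
        ((VariableChange.pointEquiv W C).toAddMonoidHom.isOfFinAddOrder hP) }
  have hDφ : ∀ P Q, D.pairing P Q =
      D'.pairing (VariableChange.pointEquiv W C P) (VariableChange.pointEquiv W C Q) := fun P Q => rfl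
  -- the canonical datum of `W`, from the Mazur–Tate pair transported to `W ⊗ ℚ_p`
  obtain ⟨D₀, hD₀⟩ : ∃ D₀ : PAdicHeightData W p, D₀.IsCanonical := by
    obtain ⟨r, s, t, hr, hs, ht⟩ := hrst
    have hvu : ‖((C.baseChange ℚ_[p]).u : ℚ_[p])‖ = 1 := by
      rw [coe_u_baseChange_padic]
      rcases hu with hu | hu <;> simp [hu]
    have hvr : ‖(C.baseChange ℚ_[p]).r‖ ≤ 1 := by
      rw [r_baseChange_padic, hr, Rat.cast_intCast]; exact Padic.norm_int_le_one r
    have hvs : ‖(C.baseChange ℚ_[p]).s‖ ≤ 1 := by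
      rw [s_baseChange_padic, hs, Rat.cast_intCast]; exact Padic.norm_int_le_one s
    have hvt : ‖(C.baseChange ℚ_[p]).t‖ ≤ 1 := by
      rw [t_baseChange_padic, ht, Rat.cast_intCast]; exact Padic.norm_int_le_one t
    have hσW : ∃ σ : ℚ_[p]⟦X⟧, ∃ c : ℚ_[p], (W.baseChange ℚ_[p]).IsMazurTateSigmaPair σ c :=
      exists_isMazurTateSigmaPair_of_variableChange (V := W.baseChange ℚ_[p])
        (vc := C.baseChange ℚ_[p]) hvu hvr hvs hvt (by rw [← baseChange_padic_smul]; exact hσ')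
    have hpair := (W.baseChange ℚ_[p]).isMazurTateSigmaPair_padicSigma hσW
    exact exists_isCanonical_of_thetaLHS_eq W p hp2
      (thetaLHS_eq_thetaRHS hpair.constantCoeff_eq hpair.coeff_one_eq hpair.odd hpair.ode)
  -- the admissible loci are subgroups
  obtain ⟨H, hH⟩ := W.exists_addSubgroup_coe_eq_localConditionsLocus p hp2
  obtain ⟨H', hH'⟩ := (C • W).exists_addSubgroup_coe_eq_localConditionsLocus p hp2
  have hmem : ∀ P, P ∈ H ↔ P = 0 ∨ W.SatisfiesLocalConditions p P := fun P => by
    rw [← SetLike.mem_coe, hH]; rfl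
  have hmem' : ∀ P, P ∈ H' ↔ P = 0 ∨ (C • W).SatisfiesLocalConditions p P := fun P => by
    rw [← SetLike.mem_coe, hH']; rfl
  have hDD₀ : D = D₀ := by
    refine PAdicHeightData.ext_of_sq_eq_on
      {Q | W.IsAdmissible p Q ∧ (C • W).IsAdmissible p (VariableChange.pointEquiv W C Q)} ?_ ?_
    · intro P hP
      have hP' : ¬ IsOfFinAddOrder (VariableChange.pointEquiv W C P) := fun hfin =>
        hP (((VariableChange.pointEquiv W C).injective.isOfFinAddOrder_iff
          (f := (VariableChange.pointEquiv W C).toAddMonoidHom)).mp hfin)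
      obtain ⟨m₁, hm₁, hP₁⟩ := exists_admissible_nsmul_holds W p P hP
      obtain ⟨m₂, hm₂, hP₂⟩ := exists_admissible_nsmul_holds (C • W) p _ hP'
      have hm : m₁ * m₂ ≠ 0 := mul_ne_zero hm₁ hm₂
      have hnt : ¬ IsOfFinAddOrder ((m₁ * m₂) • P) := fun hfin => hP (hfin.of_nsmul hm)
      have hne : (m₁ * m₂) • P ≠ 0 := fun h0 =>
        hP (isOfFinAddOrder_iff_nsmul_eq_zero.mpr ⟨m₁ * m₂, Nat.pos_of_ne_zero hm, h0⟩)
      have hnt' : ¬ IsOfFinAddOrder (VariableChange.pointEquiv W C ((m₁ * m₂) • P)) := fun hfin =>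
        hnt (((VariableChange.pointEquiv W C).injective.isOfFinAddOrder_iff
          (f := (VariableChange.pointEquiv W C).toAddMonoidHom)).mp hfin)
      have hne' : VariableChange.pointEquiv W C ((m₁ * m₂) • P) ≠ 0 := fun h0 =>
        hne ((VariableChange.pointEquiv W C).map_eq_zero_iff.mp h0)
      refine ⟨m₁ * m₂, hm, ⟨hnt, ?_⟩, ⟨hnt', ?_⟩⟩
      · have h₁ : m₁ • P ∈ H := (hmem _).mpr (Or.inr hP₁.2)
        have h₂ : (m₁ * m₂) • P ∈ H := by
          rw [mul_nsmul]; exact H.nsmul_mem h₁ m₂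
        exact ((hmem _).mp h₂).resolve_left hne
      · have h₁ : m₂ • VariableChange.pointEquiv W C P ∈ H' := (hmem' _).mpr (Or.inr hP₂.2)
        have h₂ : VariableChange.pointEquiv W C ((m₁ * m₂) • P) ∈ H' := by
          rw [map_nsmul, mul_comm, mul_nsmul]; exact H'.nsmul_mem h₁ m₁
        exact ((hmem' _).mp h₂).resolve_left hne'
    · rintro Q ⟨hQ, hQ'⟩
      rw [hDφ, hD' _ hQ', hD₀ Q hQ]
      rcases Q with _ | ⟨x, y, h⟩
      · exact (W.not_satisfiesLocalConditions_zero p hQ.2).elim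
      · obtain ⟨hx, -, -⟩ := hQ.2
        exact canonicalPAdicHeight_pointEquiv W C hp2 hgood hord hσ' hu hrst h hx
  exact ⟨D, hDD₀ ▸ hD₀, hDφ⟩

/-- **Schneider's non-degeneracy transports along an isomorphism of point groups.** If two height
data `D` on `W` and `D'` on `C • W` have pairings related by `⟨P, Q⟩_D = ⟨φ P, φ Q⟩_{D'}`
(`φ = pointEquiv W C`), then `Reg(D) ≠ 0` implies `Reg(D') ≠ 0`: a Mordell–Weil basis `B` of
`W(ℚ)` (`exists_isMordellWeilBasis_holds`) has `Reg(D) = det ⟨Bᵢ, Bⱼ⟩_D = det ⟨φBᵢ, φBⱼ⟩_{D'}`,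
a non-zero Gram determinant of `rank` points of `C • W` (`mordellWeilRank_variableChange_holds`,
`schneiderConjecture_of_padicRegulatorOf_ne_zero`). [cite: MazurTateTeitelbaum1986Invent, §II.4] -/
theorem schneiderConjecture_of_pairing_eq_pointEquiv (W : WeierstrassCurve ℚ) [W.IsElliptic]
    (C : VariableChange ℚ) (D : PAdicHeightData W p) (D' : PAdicHeightData (C • W) p)
    (hDD' : ∀ P Q, D.pairing P Q =
      D'.pairing (VariableChange.pointEquiv W C P) (VariableChange.pointEquiv W C Q))
    (hD : SchneiderConjecture D) : SchneiderConjecture D' := by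
  obtain ⟨B, hB⟩ := W.exists_isMordellWeilBasis_holds
  have hreg : padicRegulatorOf D B = padicRegulatorOf D' (VariableChange.pointEquiv W C ∘ B) := by
    unfold padicRegulatorOf PAdicHeightData.pairingMatrix
    congr 1
    ext i j
    exact hDD' _ _
  have hne : padicRegulatorOf D' (VariableChange.pointEquiv W C ∘ B) ≠ 0 := by
    rw [← hreg, hB.padicRegulatorOf_eq_padicRegulator D]; exact hD
  exact schneiderConjecture_of_padicRegulatorOf_ne_zero D'
    (by rw [Fintype.card_fin, mordellWeilRank_variableChange_holds]) hne

/-- **Transport of Schneider's conjecture for the canonical height between two globally minimal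
models.** For `W` and `C • W` globally minimal, `p` an odd prime of good ordinary reduction for `W`,
and a Mazur–Tate pair for `(C • W) ⊗ ℚ_p`: if every canonical `p`-adic height datum of `W` is
non-degenerate, so is every canonical datum of `C • W` (`exists_isCanonical_pullback` +
`schneiderConjecture_of_pairing_eq_pointEquiv`). [cite: MazurSteinTate2006, §1]
[cite: Schneider1982PadicHeightI, §1] -/
theorem schneiderConjecture_transport (W : WeierstrassCurve ℚ) [W.IsElliptic] [W.IsGloballyMinimal]
    (C : VariableChange ℚ) [(C • W).IsGloballyMinimal] (hp2 : p ≠ 2)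
    (hgood : W.HasGoodReductionAtPrime p) (hord : ¬ (p : ℤ) ∣ W.frobeniusTrace p)
    (hσ' : ∃ σ : ℚ_[p]⟦X⟧, ∃ c : ℚ_[p], ((C • W).baseChange ℚ_[p]).IsMazurTateSigmaPair σ c)
    (hS : ∀ D : PAdicHeightData W p, D.IsCanonical → SchneiderConjecture D)
    (D' : PAdicHeightData (C • W) p) (hD' : D'.IsCanonical) : SchneiderConjecture D' := by
  obtain ⟨D, hD, hDD'⟩ := exists_isCanonical_pullback W C hp2 hgood hord hσ' D' hD'
  exact schneiderConjecture_of_pairing_eq_pointEquiv W C D D' hDD' (hS D hD)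

/-- The same under the named fact `mazur_tate_sigma_exists_odd` (Mazur–Tate 1991: the sigma function
exists at every odd good ordinary prime), which supplies the pair for `(C • W) ⊗ ℚ_p` when `C • W` is
good ordinary at `p`. [cite: MazurTate1991, Thm. 3.1] [cite: MazurSteinTate2006, Thm. 1.3] -/
theorem schneiderConjecture_transport_of_mazur_tate_sigma_exists_odd (hex : mazur_tate_sigma_exists_odd)
    (W : WeierstrassCurve ℚ) [W.IsElliptic] [W.IsGloballyMinimal] (C : VariableChange ℚ)
    [(C • W).IsGloballyMinimal] (hp2 : p ≠ 2) (hgood : W.HasGoodReductionAtPrime p)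
    (hord : ¬ (p : ℤ) ∣ W.frobeniusTrace p) (hgood' : (C • W).HasGoodReductionAtPrime p)
    (hord' : ¬ (p : ℤ) ∣ (C • W).frobeniusTrace p)
    (hS : ∀ D : PAdicHeightData W p, D.IsCanonical → SchneiderConjecture D)
    (D' : PAdicHeightData (C • W) p) (hD' : D'.IsCanonical) : SchneiderConjecture D' :=
  schneiderConjecture_transport W C hp2 hgood hord (hex (C • W) p hp2 hgood' hord') hS D' hD'

end Rat

/-! ### D. The transport stub for the members of Bhargava–Ho's `F₂` at `p = 3` -/

section F2

open WeierstrassCurve Literature.NumberTheory.EllipticCurves.BhargavaHo2022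
  Summit.BirchSwinnertonDyer.Rank2 IsDedekindDomain

/-- **A member of `F₂` with square-free-sieved discriminant (`ℓ² ∤ Δ(a)` at every prime) has a
globally minimal integral model `a.curve`** (`ord_ℓ Δ ≤ 1 < 12` at every `ℓ`: Silverman VII.1
Rem. 1.1, tree `isMinimalAt_of_lt_valuation_Δ_holds`, `isGloballyMinimal_of_forall_isMinimalAt_int`).
[cite: SilvermanAEC2009, VII.1 Remark 1.1] -/
theorem isGloballyMinimal_curve_of_squarefree (a : Params)
    (hΔ : ∀ ℓ : ℕ, ℓ.Prime → ¬ ((ℓ : ℤ) ^ 2 ∣ a.curveInt.Δ)) : a.curve.IsGloballyMinimal := by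
  refine isGloballyMinimal_of_forall_isMinimalAt_int a.curve fun v => ?_
  haveI hℓ : Fact (Rat.HeightOneSpectrum.natGenerator v).Prime :=
    ⟨Rat.HeightOneSpectrum.prime_natGenerator v⟩
  have hΔ0 : a.curveInt.Δ ≠ 0 := fun h0 => hΔ 2 Nat.prime_two (by rw [h0]; exact dvd_zero _)
  have hlt : padicValInt (Rat.HeightOneSpectrum.natGenerator v) a.curveInt.Δ < 12 := by
    have h2 := hΔ _ hℓ.out
    rw [padicValInt_dvd_iff] at h2
    push Not at h2
    have := h2.2
    omega
  have hcurve : a.curve = a.curveInt.baseChange ℚ := by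
    rw [WeierstrassCurve.baseChange, algebraMap_int_eq]; rfl
  have hint : a.curve.IsIntegralAt v := by rw [hcurve]; exact isIntegralAt_baseChange_int v _
  refine isMinimalAt_of_lt_valuation_Δ_holds hint ?_
  rw [Params.curve_Δ, Rat.HeightOneSpectrum.valuation_eq_exp_neg_padicValRat v
    (by exact_mod_cast hΔ0), WithZero.exp_lt_exp, padicValRat.of_int, neg_lt_neg_iff]
  exact_mod_cast hlt

/-- The local data of a globally minimal member at `3` from those of any globally minimal model
`C • a.curve` ordinary at `3`: `a.curve` is good ordinary at `3` (`a_3` of both models is the point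
count of `curveInt a`, `F2Member.frobeniusTrace_smul_curve`; good reduction is an isomorphism
invariant). [cite: SilvermanAEC2009, Exercise 8.19(a) and Prop. VII.1.3(b)] -/
theorem good_ordinary_three_curve_of_smul (a : Params) (h : a.IsMember) [a.curve.IsGloballyMinimal]
    (C : VariableChange ℚ) [hC : (C • a.curve).IsGloballyMinimal] (hord : IsOrdinaryAt (C • a.curve) 3) :
    a.curve.HasGoodReductionAtPrime 3 ∧ ¬ ((3 : ℕ) : ℤ) ∣ a.curve.frobeniusTrace 3 := by
  haveI : a.curve.IsElliptic := Params.isElliptic_curve h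
  obtain ⟨hgood', hord'⟩ := hord
  have hgood : a.curve.HasGoodReductionAtPrime 3 :=
    (BSZLemma17.hasGoodReductionAtPrime_smul_iff a.curve C 3).mp hgood'
  have h3Δ : ¬ ((3 : ℕ) : ℤ) ∣ a.curveInt.Δ := by
    intro hdvd
    have h1 := norm_Δ_baseChange_eq_one_of_hasGoodReductionAtPrime a.curve 3 hgood
    have h2 : (a.curve.baseChange ℚ_[3]).Δ = ((a.curveInt.Δ : ℤ) : ℚ_[3]) := by
      rw [WeierstrassCurve.baseChange, map_Δ, Params.curve_Δ, eq_ratCast, Rat.cast_intCast]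
    rw [h2] at h1
    exact absurd h1 (ne_of_lt (Padic.norm_intCast_lt_one_iff.mpr hdvd))
  have htrC := (F2Member.frobeniusTrace_smul_curve a C 3 h3Δ).2
  have htr := (frobeniusTrace_eq_of_smul_map_eq a.curveInt a.curve 1 (one_smul _ _) 3 h3Δ).2
  exact ⟨hgood, by rw [htr, ← htrC]; exact hord'⟩

/-- **`stub_transport` (v3) of line `valuation-class-at-three` (crux I4loc `SchneiderOnDoorSubfamily`),
from a Mazur–Tate pair for the member's own model at `3`.** For a member `a` of `F₂` with
square-free-sieved discriminant (so `a.curve` is globally minimal and every `C` to another globally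
minimal model has `u = ±1`, `r, s, t ∈ ℤ`) such that a Mazur–Tate `3`-adic sigma pair exists for
`a.curve ⊗ ℚ_3`: if every canonical `3`-adic height datum of `a.curve` is non-degenerate when
`rank a.curve(ℚ) = 2`, then for every globally minimal model `C • a.curve` ordinary at `3` of
Mordell–Weil rank `2`, every canonical `3`-adic height datum is non-degenerate. The extra hypothesis
`hσ` is what makes `PAdicHeightData.IsCanonical` model-invariant (without a Mazur–Tate pair the
chosen sigma series is the junk value `t` on both models and the sigma formula is NOT invariant under
`r, s, t ≠ 0`). [cite: MazurSteinTate2006, Thm. 1.3 and §1] [cite: SilvermanAEC2009, VII.1.3(b) and VIII.8.3] -/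
theorem schClause_of_exists_mazurTatePair (a : Params) (h : a.IsMember)
    (hΔ : ∀ ℓ : ℕ, ℓ.Prime → ¬ ((ℓ : ℤ) ^ 2 ∣ a.curveInt.Δ))
    (hσ : ∃ σ : ℚ_[3]⟦X⟧, ∃ c : ℚ_[3], (a.curve.baseChange ℚ_[3]).IsMazurTateSigmaPair σ c)
    (hS : ∀ Dh : PAdicHeightData a.curve 3, Dh.IsCanonical → a.curve.mordellWeilRank = 2 →
      SchneiderConjecture Dh) :
    ∀ (C : VariableChange ℚ) (hC : (C • a.curve).IsGloballyMinimal),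
      @IsOrdinaryAt (C • a.curve) hC 3 _ → (C • a.curve).mordellWeilRank = 2 →
        ∀ Dh : PAdicHeightData (C • a.curve) 3, Dh.IsCanonical → SchneiderConjecture Dh := by
  intro C hC hordC hrank Dh hDh
  haveI : a.curve.IsElliptic := Params.isElliptic_curve h
  haveI : a.curve.IsGloballyMinimal := isGloballyMinimal_curve_of_squarefree a hΔ
  obtain ⟨hgood, hord⟩ := good_ordinary_three_curve_of_smul a h C hordC
  have hrankW : a.curve.mordellWeilRank = 2 := by
    rw [← mordellWeilRank_variableChange_holds a.curve C]; exact hrank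
  exact schneiderConjecture_transport a.curve C (by norm_num) hgood hord
    (exists_mazurTatePair_smul a.curve C hσ) (fun D hD => hS D hD hrankW) Dh hDh

/-- **`stub_transport` (v3) of line `valuation-class-at-three` under the named fact
`mazur_tate_sigma_exists_odd`** (Mazur–Tate 1991, Thm. 3.1 = conjunct 2 of the route's
`PublishedInputsAtThree`): the registered signature with the fact as an extra hypothesis. For a member
of `F₂` with square-free-sieved discriminant, Schneider's non-degeneracy of every canonical `3`-adic
height datum on the member's model (in rank `2`) transfers to every canonical datum on every globally
minimal model `C • a.curve` ordinary at `3` of Mordell–Weil rank `2`.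
[cite: MazurTate1991, Thm. 3.1] [cite: MazurSteinTate2006, Thm. 1.3 and §1]
[cite: SilvermanAEC2009, VII.1.3(b) and VIII.8.3] -/
theorem schClause_of_mazur_tate_sigma_exists_odd (hex : mazur_tate_sigma_exists_odd) (a : Params)
    (h : a.IsMember) (hΔ : ∀ ℓ : ℕ, ℓ.Prime → ¬ ((ℓ : ℤ) ^ 2 ∣ a.curveInt.Δ))
    (hS : ∀ Dh : PAdicHeightData a.curve 3, Dh.IsCanonical → a.curve.mordellWeilRank = 2 →
      SchneiderConjecture Dh) :
    ∀ (C : VariableChange ℚ) (hC : (C • a.curve).IsGloballyMinimal),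
      @IsOrdinaryAt (C • a.curve) hC 3 _ → (C • a.curve).mordellWeilRank = 2 →
        ∀ Dh : PAdicHeightData (C • a.curve) 3, Dh.IsCanonical → SchneiderConjecture Dh := by
  intro C hC hordC hrank Dh hDh
  haveI : a.curve.IsElliptic := Params.isElliptic_curve h
  haveI : a.curve.IsGloballyMinimal := isGloballyMinimal_curve_of_squarefree a hΔ
  obtain ⟨hgood, hord⟩ := good_ordinary_three_curve_of_smul a h C hordC
  have hrankW : a.curve.mordellWeilRank = 2 := by
    rw [← mordellWeilRank_variableChange_holds a.curve C]; exact hrank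
  exact schneiderConjecture_transport_of_mazur_tate_sigma_exists_odd hex a.curve C (by norm_num) hgood
    hord hordC.1 hordC.2 (fun D hD => hS D hD hrankW) Dh hDh

end F2

end Summit.BirchSwinnertonDyer.BirchSwinnertonDyer.Theorems

end
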